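import Mathlib

/-!
# Band-limited fixed-point iteration: the grid size is a phantom cost parameter (DEQ-A158)

HONEST FRAMING: instance-level adjudication of specific advantage claims; no claim about BQP vs BPP
or the summit.

Context. Wang, Ortiz, Cirak, ‘QAFE²: Quantum accelerated multiscale finite element analysis’,
arXiv:2604.06130v2 = Comput. Methods Appl. Mech. Engrg. 461 (2026) 119204, run the basic
Moulinec–Suquet scheme `γ^{(s+1)} = γ̄ − Γ⁰[(µ − µ₀) γ^{(s)}]`, `γ^{(0)} = γ̄`, for a FIXED number `S`
of steps on an `N^d` grid inside a quantum circuit and read out the cell-averaged stress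
`σ̄^{(S)} = ⟨µ γ^{(S)}⟩`; the modulus fluctuation `µ − µ₀` entering the circuit is a fixed low-degree
polynomial surrogate (degree 8 in 1D, degree ≤ 4 per coordinate in 2D). The advertised speed-up is
measured in `N` (`O(log^c N)` versus the classical `O(N² log N)`).

What is proved here (Mathlib only, no `sorry`, no axioms) is the algebraic core of the observation
that `N` is then a phantom parameter. Trigonometric polynomials on the `d`-torus are modelled as the
group algebra `AddMonoidAlgebra ℂ (Fin d → ℤ)` of the frequency lattice (`single k c` is the mode
`c·e^{2πi k·x}`; the product is the Cauchy product, i.e. pointwise multiplication of functions); a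
Fourier multiplier — the periodic Green operator `Γ⁰` of the homogeneous reference medium, the mean-removal
projector — is any self-map that does not enlarge Fourier supports.

* `BandLimited.mul` — bandwidths add under products (`box K₁ + box K₂ ⊆ box (K₁ + K₂)`);
* `bandLimited_basicScheme` — if `µ − µ₀` has bandwidth `q` and the datum `γ̄` is constant, the `s`-th
  iterate has bandwidth `s·q`, and (`bandLimited_stress`) the stress `µ γ^{(S)}` whose zero mode is
  the output has bandwidth `(S+1)·q` — uniformly in any grid;
* `modN_injOn_box` — on a grid with `N > 2K` points per direction, distinct frequencies of sup-norm
  `≤ K` stay distinct modulo `N` (no aliasing), and (`modN_eq_zero_iff`) for `N > K` the only such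
  frequency that is `≡ 0 (mod N)` is `0` (the grid mean of a bandwidth-`K` polynomial is its true mean).

Consequence (DEQ-A158 Theorem A, proved in prose in `papers/QuantumAdvantage/dequantization/
DEQ-A158.md` from these two facts by induction over the steps, each step being ‘pointwise product, then
multiplier’): for every grid with `N > 2·S·q` points per direction the grid iterates are the exact
samples of the continuum iterates and the read-out number `σ̄_N^{(S)}` does not depend on `N` at all; it
is computed classically with `S` FFT sweeps on the smallest admissible grid, i.e. in
`O(S (S q)^d log(S q))` operations, and reproduced to `10⁻¹⁷` by two independent implementations on
grids from `2^5` to `2^22` points (NUMERICS-A158.md). The comparison ‘`log^c N` versus `N² log N`’ is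
therefore a comparison in a parameter on which the computed quantity does not depend.
-/

noncomputable section

namespace Summit.QuantumAdvantage.Dequantization.BandLimitedFixedPoint

open Finset
open scoped Pointwise

variable {d : ℕ}

/-- Trigonometric polynomials on the `d`-torus with complex coefficients: the group algebra of the
frequency lattice `ℤ^d`. -/
abbrev TrigPoly (d : ℕ) : Type := AddMonoidAlgebra ℂ (Fin d → ℤ)

/-- The Fourier support of a trigonometric polynomial. -/
abbrev fsupp (x : TrigPoly d) : Finset (Fin d → ℤ) := x.coeff.support

/-- The cube of frequencies of sup-norm at most `K`. -/
def box (d K : ℕ) : Finset (Fin d → ℤ) := Fintype.piFinset fun _ => Finset.Icc (-(K : ℤ)) K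

/-- Membership in the cube: `|k_i| ≤ K` for every coordinate. -/
theorem mem_box {K : ℕ} {k : Fin d → ℤ} : k ∈ box d K ↔ ∀ i, |k i| ≤ K := by
  unfold box
  rw [Fintype.mem_piFinset]
  refine forall_congr' fun i => ?_
  rw [Finset.mem_Icc, abs_le]

/-- The zero frequency lies in every cube. -/
theorem zero_mem_box (K : ℕ) : (0 : Fin d → ℤ) ∈ box d K := by
  rw [mem_box]
  intro i
  simp

/-- The cubes are nested. -/
theorem box_mono {K K' : ℕ} (h : K ≤ K') : box d K ⊆ box d K' := by
  intro k hk
  rw [mem_box] at hk ⊢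
  intro i
  have h1 := hk i
  have h2 : ((K : ℕ) : ℤ) ≤ ((K' : ℕ) : ℤ) := by exact_mod_cast h
  exact h1.trans h2

/-- Frequencies add under products, so bandwidths add. -/
theorem add_mem_box {K₁ K₂ : ℕ} {p q : Fin d → ℤ} (hp : p ∈ box d K₁) (hq : q ∈ box d K₂) :
    p + q ∈ box d (K₁ + K₂) := by
  rw [mem_box] at hp hq ⊢
  intro i
  have h1 := hp i
  have h2 := hq i
  rw [abs_le] at h1 h2
  rw [abs_le]
  simp only [Pi.add_apply, Nat.cast_add]
  omega

/-- `x` is band-limited with (sup-norm) bandwidth `K`. -/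
def BandLimited (x : TrigPoly d) (K : ℕ) : Prop := fsupp x ⊆ box d K

/-- A larger bandwidth bound is still a bound. -/
theorem BandLimited.mono {x : TrigPoly d} {K K' : ℕ} (hx : BandLimited x K) (h : K ≤ K') :
    BandLimited x K' :=
  fun _ hk => box_mono h (hx hk)

/-- Sums do not enlarge the bandwidth. -/
theorem BandLimited.add {x y : TrigPoly d} {K : ℕ} (hx : BandLimited x K) (hy : BandLimited y K) :
    BandLimited (x + y) K := by
  intro k hk
  unfold fsupp at hk
  rw [AddMonoidAlgebra.coeff_add] at hk
  rcases Finset.mem_union.mp (Finsupp.support_add hk) with h | h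
  · exact hx h
  · exact hy h

/-- Bandwidths add under the product (pointwise multiplication of the functions = Cauchy product of
the coefficient families). -/
theorem BandLimited.mul {x y : TrigPoly d} {K₁ K₂ : ℕ} (hx : BandLimited x K₁)
    (hy : BandLimited y K₂) : BandLimited (x * y) (K₁ + K₂) := by
  intro k hk
  have h := AddMonoidAlgebra.support_coeff_mul_subset x y hk
  obtain ⟨p, hp, q, hq, rfl⟩ := Finset.mem_add.mp h
  exact add_mem_box (hx hp) (hy hq)

/-- A constant field (frequency `0` only) has bandwidth `0`. -/
theorem bandLimited_single_zero (c : ℂ) : BandLimited (AddMonoidAlgebra.single (0 : Fin d → ℤ) c) 0 := by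
  intro k hk
  unfold fsupp at hk
  have hk₁ : k ∈ (Finsupp.single (0 : Fin d → ℤ) c).support := hk
  have hk' : k ∈ ({(0 : Fin d → ℤ)} : Finset (Fin d → ℤ)) := Finsupp.support_single_subset hk₁
  rw [Finset.mem_singleton] at hk'
  rw [hk']
  exact zero_mem_box 0

/-- A Fourier multiplier: a self-map acting frequency by frequency, hence never enlarging the Fourier
support (the periodic Green operator `Γ⁰` of the reference medium; the projector removing the mean). -/
def IsMultiplier (Γ : TrigPoly d → TrigPoly d) : Prop := ∀ y, fsupp (Γ y) ⊆ fsupp y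

/-- The basic fixed-point scheme of FFT-based homogenisation with the sign absorbed into `Γ`:
`γ^{(0)} = E`, `γ^{(s+1)} = E + Γ (m · γ^{(s)})`, where `m = µ − µ₀` is the modulus fluctuation and
`E` the prescribed (constant) macroscopic strain. -/
def basicScheme (Γ : TrigPoly d → TrigPoly d) (m E : TrigPoly d) : ℕ → TrigPoly d
  | 0 => E
  | s + 1 => E + Γ (m * basicScheme Γ m E s)

/-- **Bandwidth of the iterates.** If the modulus fluctuation has bandwidth `q` and the datum is a
constant, the `s`-th iterate of the basic scheme has bandwidth `s·q` — whatever grid, if any, is used to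
carry it. -/
theorem bandLimited_basicScheme {Γ : TrigPoly d → TrigPoly d} (hΓ : IsMultiplier Γ)
    {m E : TrigPoly d} {q : ℕ} (hm : BandLimited m q) (hE : BandLimited E 0) :
    ∀ s, BandLimited (basicScheme Γ m E s) (s * q)
  | 0 => by
      show BandLimited E (0 * q)
      rw [Nat.zero_mul]
      exact hE
  | s + 1 => by
      have ih := bandLimited_basicScheme hΓ hm hE s
      have hprod : BandLimited (m * basicScheme Γ m E s) (q + s * q) := hm.mul ih
      have hΓprod : BandLimited (Γ (m * basicScheme Γ m E s)) ((s + 1) * q) := by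
        intro k hk
        have h := hprod (hΓ _ hk)
        rw [show (s + 1) * q = q + s * q by ring]
        exact h
      show BandLimited (E + Γ (m * basicScheme Γ m E s)) ((s + 1) * q)
      exact (hE.mono (Nat.zero_le _)).add hΓprod

/-- **Bandwidth of the read-out.** The stress `µ γ^{(S)} = (µ₀ + m) γ^{(S)}`, whose cell average (zero
mode) is the number the QAFE² circuit outputs, has bandwidth `(S+1)·q`. -/
theorem bandLimited_stress {Γ : TrigPoly d → TrigPoly d} (hΓ : IsMultiplier Γ)
    {m E : TrigPoly d} {q : ℕ} (hm : BandLimited m q) (hE : BandLimited E 0) (mu0 : ℂ) (S : ℕ) :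
    BandLimited ((AddMonoidAlgebra.single 0 mu0 + m) * basicScheme Γ m E S) ((S + 1) * q) := by
  have hmu : BandLimited (AddMonoidAlgebra.single (0 : Fin d → ℤ) mu0 + m) q :=
    ((bandLimited_single_zero mu0).mono (Nat.zero_le _)).add hm
  have h := hmu.mul (bandLimited_basicScheme hΓ hm hE S)
  rw [show (S + 1) * q = q + S * q by ring]
  exact h

/-! ## No aliasing on a grid with more than `2K` points per direction -/

/-- Reduction of a frequency modulo the grid size (the DFT bin it falls into). -/
def modN (N : ℕ) (k : Fin d → ℤ) : Fin d → ZMod N := fun i => ((k i : ℤ) : ZMod N)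

/-- Reduction modulo the grid size is additive. -/
theorem modN_sub (N : ℕ) (k l : Fin d → ℤ) : modN N (k - l) = modN N k - modN N l := by
  funext i
  simp [modN]

/-- A frequency with all entries below `N` in absolute value falls into bin `0` only if it is `0`:
the grid mean of a polynomial of bandwidth `< N` equals its true mean. -/
theorem modN_eq_zero_iff {N : ℕ} {v : Fin d → ℤ} (hv : ∀ i, |v i| < N) : modN N v = 0 ↔ v = 0 := by
  constructor
  · intro h
    funext i
    have hi : ((v i : ℤ) : ZMod N) = 0 := congrFun h i
    rw [ZMod.intCast_zmod_eq_zero_iff_dvd] at hi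
    exact Int.eq_zero_of_abs_lt_dvd hi (hv i)
  · rintro rfl
    funext i
    simp [modN]

/-- **No aliasing.** On a grid with `N > 2K` points per direction, two frequencies of sup-norm `≤ K`
that fall into the same DFT bin are equal; hence the DFT of the samples of a bandwidth-`K` polynomial
returns its true Fourier coefficients, bin by bin, and a multiplier applied bin-wise is applied exactly. -/
theorem modN_injOn_box {K N : ℕ} (hN : 2 * K < N) :
    Set.InjOn (modN (d := d) N) (box d K : Set (Fin d → ℤ)) := by
  intro p hp k hk h
  have hp' : p ∈ box d K := by exact_mod_cast hp
  have hk' : k ∈ box d K := by exact_mod_cast hk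
  rw [mem_box] at hp' hk'
  have hsub : modN N (p - k) = 0 := by
    rw [modN_sub, h, sub_self]
  have hlt : ∀ i, |(p - k) i| < N := by
    intro i
    have h1 := hp' i
    have h2 := hk' i
    have hN' : ((2 * K : ℕ) : ℤ) < (N : ℤ) := by exact_mod_cast hN
    rw [abs_le] at h1 h2
    rw [abs_lt]
    simp only [Pi.sub_apply]
    push_cast at hN'
    omega
  have := (modN_eq_zero_iff hlt).mp hsub
  exact sub_eq_zero.mp this

/-- The grid-mean form used for the read-out: with `N > K`, a nonzero frequency of sup-norm `≤ K` is
not in bin `0`. -/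
theorem modN_ne_zero_of_mem_box {K N : ℕ} (hN : K < N) {k : Fin d → ℤ} (hk : k ∈ box d K)
    (hk0 : k ≠ 0) : modN N k ≠ 0 := by
  intro h
  rw [mem_box] at hk
  have hlt : ∀ i, |k i| < N := by
    intro i
    have h1 := hk i
    have hN' : ((K : ℕ) : ℤ) < (N : ℤ) := by exact_mod_cast hN
    exact lt_of_le_of_lt h1 hN'
  exact hk0 ((modN_eq_zero_iff hlt).mp h)

end Summit.QuantumAdvantage.Dequantization.BandLimitedFixedPoint

end
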